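import Literature.NumberTheory.GaloisRepresentations.LabelledWeightsDeRhamRank
import HarnessLib

/-!
# Labelled Hodge–Tate weights under extension of the coefficient model (rank one)

For a period-ring datum `𝔅` of `Γ` over `F/P`, a tower of coefficient fields `P ⊆ E₀ ⊆ E` and the
inclusion `ι : E₀ⁿ ⊗_P B → Eⁿ ⊗_P B` (`PeriodRingData.coeffIncl`):

* `coeffIncl_mem_coeffFilTensor_iff` — **membership in `M ⊗ Fil^i B` descends**:
  `ι x ∈ Eⁿ ⊗ Fil^i B ↔ x ∈ E₀ⁿ ⊗ Fil^i B` (an `E₀`-linear retraction `E → E₀` induces a `P`-linear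
  retraction of `ι` preserving `· ⊗ Fil^i B`);
* `coeffIncl_injective` — `ι` is injective;
* `labelledHodgeTateWeights_baseChange_of_finrank_eq_one` — for a rank-one `r₀ : Γ → GL₁(E₀)` with
  `E₀` splitting `F` and `D_{τ₀}(r₀)` an `E₀`-line, the labelled weights of the base change
  `r = r₀ ⊗_{E₀} E` at `τ = (E₀ ⊆ E) ∘ τ₀` are those of `r₀` at `τ₀` (both `D_τ` are lines,
  `D_τ(r) = E · ι(D_{τ₀}(r₀))` by the accepted `labelD_baseChange_eq_span`, and a line's filtration is
  read off its generator).

## References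
* [Patrikis2019] S. Patrikis, *Variations on a theorem of Tate*, §2.3.1, §2.7.1 (labelled weights and
  change of coefficients).
* [FontaineAsterisque223III] J.-M. Fontaine, Astérisque 223, Exp. III §1.5, Prop. 1.5.2.
-/

noncomputable section

open scoped TensorProduct
open TensorProduct

universe u v v'

namespace Literature.NumberTheory.GaloisRepresentations

namespace PeriodRingData

section Descent

-- Mathlib's own global value of `maxSynthPendingDepth` (see `LabelledWeightsTwist`); the large
-- tensor types also need a higher instance-synthesis budget.
set_option maxSynthPendingDepth 3
set_option synthInstance.maxHeartbeats 100000

variable {Γ : Type u} [Group Γ] [TopologicalSpace Γ] {P : Type v} {F : Type v'} [Field P] [Field F] [Algebra P F]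
  {E₀ E : Type*} [Field E₀] [Field E] [Algebra P E₀] [Algebra P E] [Algebra E₀ E] [IsScalarTower P E₀ E]
  [TopologicalSpace E₀] [TopologicalSpace E] [IsTopologicalRing E₀] [IsTopologicalRing E]
  (𝔅 : PeriodRingData.{u, v, v', _} Γ P F) (n : ℕ)

omit [TopologicalSpace Γ] [TopologicalSpace E] [IsTopologicalRing E] in
/-- Pure tensors `m ⊗ b` with `b ∈ Fil^i B` lie in `M ⊗ Fil^i B` (restated from the accepted
`LabelFilDTransport.tmul_mem_coeffFilTensor` to keep the import closure small). [folklore] -/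
private theorem tmul_mem_coeffFilTensor' {M : Type*} [AddCommGroup M] [Module E M] [Module P M]
    [IsScalarTower P E M] {i : ℤ} (m : M) {b : 𝔅.B} (hb : b ∈ 𝔅.fil i) :
    m ⊗ₜ[P] b ∈ 𝔅.coeffFilTensor E M i :=
  ⟨m ⊗ₜ ⟨b, hb⟩, rfl⟩

omit [TopologicalSpace Γ] [TopologicalSpace E] [IsTopologicalRing E] in
/-- Induction principle for `M ⊗ Fil^i B` (restated, as above). [folklore] -/
private theorem coeffFilTensor_induction' {M : Type*} [AddCommGroup M] [Module E M] [Module P M]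
    [IsScalarTower P E M] {i : ℤ} {C : M ⊗[P] 𝔅.B → Prop} (h0 : C 0)
    (htmul : ∀ (m : M) (b : 𝔅.B), b ∈ 𝔅.fil i → C (m ⊗ₜ b))
    (hadd : ∀ x y, C x → C y → C (x + y)) {x : M ⊗[P] 𝔅.B} (hx : x ∈ 𝔅.coeffFilTensor E M i) :
    C x := by
  obtain ⟨y, rfl⟩ := hx
  induction y using TensorProduct.induction_on with
  | zero => simpa using h0
  | tmul m b => exact htmul m b b.2
  | add y z hy hz => simpa using hadd _ _ hy hz

omit [TopologicalSpace Γ] [TopologicalSpace E₀] [TopologicalSpace E] [IsTopologicalRing E₀] [IsTopologicalRing E] in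
/-- **A retraction of `ι` preserving `· ⊗ Fil^i B`**: there is a `P`-linear `R : Eⁿ ⊗ B → E₀ⁿ ⊗ B` with
`R ∘ ι = id` and `R (Eⁿ ⊗ Fil^i B) ⊆ E₀ⁿ ⊗ Fil^i B` (namely `g^n ⊗ id` for an `E₀`-linear retraction
`g : E → E₀` of `E₀ ⊆ E`): base change along a field extension is faithfully flat.
[cite: Lang1965Algebra, Ch. XVI §4 (flatness of free modules; field extensions)] -/
theorem exists_retraction_coeffIncl :
    ∃ R : (Fin n → E) ⊗[P] 𝔅.B →ₗ[P] (Fin n → E₀) ⊗[P] 𝔅.B,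
      (∀ x, R (𝔅.coeffIncl (E := E) n x) = x) ∧
        ∀ (i : ℤ) (y : (Fin n → E) ⊗[P] 𝔅.B), y ∈ 𝔅.coeffFilTensor E (Fin n → E) i →
          R y ∈ 𝔅.coeffFilTensor E₀ (Fin n → E₀) i := by
  obtain ⟨g, hg⟩ := (Algebra.linearMap E₀ E).exists_leftInverse_of_injective
    (LinearMap.ker_eq_bot.2 (algebraMap E₀ E).injective)
  refine ⟨TensorProduct.map ((g.restrictScalars P).compLeft (Fin n)) LinearMap.id, fun x => ?_,
    fun i y hy => ?_⟩
  · induction x using TensorProduct.induction_on with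
    | zero => simp only [map_zero]
    | tmul m b =>
      rw [coeffIncl_tmul, TensorProduct.map_tmul, LinearMap.id_apply]
      congr 1
      funext k
      exact LinearMap.congr_fun hg (m k)
    | add x y hx hy => rw [map_add, map_add, hx, hy]
  · refine 𝔅.coeffFilTensor_induction' (E := E) (M := Fin n → E)
      (C := fun y => TensorProduct.map ((g.restrictScalars P).compLeft (Fin n)) LinearMap.id y ∈
        𝔅.coeffFilTensor E₀ (Fin n → E₀) i) ?_ (fun m b hb => ?_) (fun y z hy hz => ?_) hy
    · rw [map_zero]; exact zero_mem _
    · rw [TensorProduct.map_tmul, LinearMap.id_apply]; exact 𝔅.tmul_mem_coeffFilTensor' _ hb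
    · rw [map_add]; exact add_mem hy hz

omit [TopologicalSpace Γ] [TopologicalSpace E₀] [TopologicalSpace E] [IsTopologicalRing E₀] [IsTopologicalRing E] in
/-- **`ι : E₀ⁿ ⊗_P B → Eⁿ ⊗_P B` is injective** (base change along a field extension).
[cite: Lang1965Algebra, Ch. XVI §4 (flatness of free modules; field extensions)] -/
theorem coeffIncl_injective : Function.Injective (𝔅.coeffIncl (E₀ := E₀) (E := E) n) := by
  obtain ⟨R, hR, -⟩ := 𝔅.exists_retraction_coeffIncl (E₀ := E₀) (E := E) n
  exact fun x y hxy => by rw [← hR x, ← hR y, hxy]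

omit [TopologicalSpace Γ] [TopologicalSpace E₀] [TopologicalSpace E] [IsTopologicalRing E₀] [IsTopologicalRing E] in
/-- **Membership in `M ⊗ Fil^i B` descends along the coefficient extension**:
`ι x ∈ Eⁿ ⊗ Fil^i B ↔ x ∈ E₀ⁿ ⊗ Fil^i B`. [cite: Patrikis2019, §2.7.1] -/
theorem coeffIncl_mem_coeffFilTensor_iff (i : ℤ) (x : (Fin n → E₀) ⊗[P] 𝔅.B) :
    𝔅.coeffIncl (E := E) n x ∈ 𝔅.coeffFilTensor E (Fin n → E) i ↔
      x ∈ 𝔅.coeffFilTensor E₀ (Fin n → E₀) i := by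
  constructor
  · intro hx
    obtain ⟨R, hR, hRfil⟩ := 𝔅.exists_retraction_coeffIncl (E₀ := E₀) (E := E) n
    rw [← hR x]
    exact hRfil i _ hx
  · intro hx
    refine 𝔅.coeffFilTensor_induction' (E := E₀) (M := Fin n → E₀)
      (C := fun y => 𝔅.coeffIncl (E := E) n y ∈ 𝔅.coeffFilTensor E (Fin n → E) i)
      ?_ (fun m b hb => ?_) (fun y z hy hz => ?_) hx
    · rw [map_zero]; exact zero_mem _
    · rw [coeffIncl_tmul]; exact 𝔅.tmul_mem_coeffFilTensor' _ hb
    · rw [map_add]; exact add_mem hy hz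

/-! ### Rank one: the labelled weights of the base change -/

variable {n}

omit [TopologicalSpace E₀] [TopologicalSpace E] [IsTopologicalRing E₀] [IsTopologicalRing E] in
/-- The filtration of an `E₀`-LINE `D_{τ₀}` is read off a generator: `dim Fil^i D_{τ₀} = 1` if the
generator lies in `E₀ⁿ ⊗ Fil^i B`, else `0` (the Hodge–Tate weight of a character).
[cite: Patrikis2019, §2.3.1] -/
theorem finrank_labelFilD_eq_ite_of_finrank_eq_one [TopologicalSpace E₀]
    (ρ₀ : ContinuousRep Γ E₀ (Fin n → E₀)) (τ₀ : F →+* E₀)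
    [FiniteDimensional E₀ (𝔅.labelD ρ₀ τ₀)] (h1 : Module.finrank E₀ (𝔅.labelD ρ₀ τ₀) = 1)
    {x₀ : (Fin n → E₀) ⊗[P] 𝔅.B} (hx₀D : x₀ ∈ 𝔅.labelD ρ₀ τ₀) (hx₀ : x₀ ≠ 0) (i : ℤ)
    [Decidable (x₀ ∈ 𝔅.coeffFilTensor E₀ (Fin n → E₀) i)] :
    Module.finrank E₀ (𝔅.labelFilD ρ₀ τ₀ i) =
      if x₀ ∈ 𝔅.coeffFilTensor E₀ (Fin n → E₀) i then 1 else 0 := by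
  haveI : FiniteDimensional E₀ (𝔅.labelFilD ρ₀ τ₀ i) :=
    Submodule.finiteDimensional_of_le (𝔅.labelFilD_le ρ₀ τ₀ i)
  have hle : Module.finrank E₀ (𝔅.labelFilD ρ₀ τ₀ i) ≤ 1 :=
    (Submodule.finrank_mono (𝔅.labelFilD_le ρ₀ τ₀ i)).trans h1.le
  split_ifs with hmem
  · -- `x₀ ∈ Fil^i D_{τ₀}`, a nonzero element of a space of dimension `≤ 1`
    have hx : x₀ ∈ 𝔅.labelFilD ρ₀ τ₀ i := Submodule.mem_inf.2 ⟨hx₀D, hmem⟩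
    have hpos : 0 < Module.finrank E₀ (𝔅.labelFilD ρ₀ τ₀ i) := by
      rw [Module.finrank_pos_iff_exists_ne_zero]
      exact ⟨⟨x₀, hx⟩, fun h => hx₀ (congrArg Subtype.val h)⟩
    omega
  · -- every element of the line `D_{τ₀}` is a multiple of `x₀`
    suffices h : 𝔅.labelFilD ρ₀ τ₀ i = ⊥ by rw [h, finrank_bot]
    rw [Submodule.eq_bot_iff]
    intro y hy
    obtain ⟨c, hc⟩ := (finrank_eq_one_iff_of_nonzero' (⟨x₀, hx₀D⟩ : 𝔅.labelD ρ₀ τ₀)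
      (fun h => hx₀ (congrArg Subtype.val h))).1 h1 ⟨y, 𝔅.labelFilD_le ρ₀ τ₀ i hy⟩
    have hcy : c • x₀ = y := congrArg Subtype.val hc
    by_contra hy0
    have hc0 : c ≠ 0 := by rintro rfl; exact hy0 (by rw [← hcy, zero_smul])
    apply hmem
    have : x₀ = c⁻¹ • y := by rw [← hcy, smul_smul, inv_mul_cancel₀ hc0, one_smul]
    rw [this]
    exact Submodule.smul_mem _ _ (Submodule.mem_inf.1 hy).2

/-- **Rank one: the labelled Hodge–Tate weights are unchanged by extension of the coefficient
model.**  For `r₀ : Γ → GL₁(E₀)` with `E₀ ⊇` the `[F:P]` embeddings of `F` and `D_{τ₀}(r₀)` an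
`E₀`-line (e.g. `r₀` admissible for a field `B`, accepted `finrank_labelD_eq_of_isAdmissible`), and
`E/E₀` any (topological) field extension: `HT_τ(r₀ ⊗_{E₀} E) = HT_{τ₀}(r₀)` for `τ = (E₀ ⊆ E) ∘ τ₀`.
(`D_τ(r) = E · ι(D_{τ₀})` is an `E`-line generated by `ι x₀`, and `ι x₀ ∈ E ⊗ Fil^i ↔ x₀ ∈ E₀ ⊗ Fil^i`.)
[cite: Patrikis2019, §2.3.1 and §2.7.1] [cite: FontaineAsterisque223III, Exp. III Prop. 1.5.2] -/
theorem labelledHodgeTateWeights_baseChange_of_finrank_eq_one [FiniteDimensional P F]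
    [Algebra.IsSeparable P F] (r₀ : FramedRep Γ E₀ 1) (hc : Continuous (algebraMap E₀ E))
    (hsplit₀ : Fintype.card (F →ₐ[P] E₀) = Module.finrank P F) (τ₀ : F →ₐ[P] E₀)
    [FiniteDimensional E₀ (𝔅.labelD (FramedRep.toContinuousRep r₀) τ₀.toRingHom)]
    (h1 : Module.finrank E₀ (𝔅.labelD (FramedRep.toContinuousRep r₀) τ₀.toRingHom) = 1) :
    𝔅.labelledHodgeTateWeights (FramedRep.toContinuousRep (r₀.baseChange (algebraMap E₀ E) hc))
        (extEmb (E := E) τ₀).toRingHom =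
      𝔅.labelledHodgeTateWeights (FramedRep.toContinuousRep r₀) τ₀.toRingHom := by
  classical
  -- a generator `x₀` of the `E₀`-line `D_{τ₀}(r₀)`
  have hne : 𝔅.labelD (FramedRep.toContinuousRep r₀) τ₀.toRingHom ≠ ⊥ := by
    intro h; rw [h, finrank_bot] at h1; exact zero_ne_one h1
  obtain ⟨x₀, hx₀D, hx₀⟩ := Submodule.exists_mem_ne_zero_of_ne_bot hne
  -- `ι x₀` is a generator of the `E`-line `D_τ(r)`
  have hιD : 𝔅.coeffIncl (E := E) 1 x₀ ∈
      𝔅.labelD (FramedRep.toContinuousRep (r₀.baseChange (algebraMap E₀ E) hc))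
        (extEmb (E := E) τ₀).toRingHom :=
    𝔅.coeffIncl_mem_labelD r₀ hc τ₀ hx₀D
  have hι0 : 𝔅.coeffIncl (E := E) 1 x₀ ≠ 0 := fun h =>
    hx₀ (𝔅.coeffIncl_injective (E₀ := E₀) (E := E) 1 (by rw [h, map_zero]))
  haveI : FiniteDimensional E (𝔅.labelD (FramedRep.toContinuousRep
      (r₀.baseChange (algebraMap E₀ E) hc)) (extEmb (E := E) τ₀).toRingHom) := by
    rw [𝔅.labelD_baseChange_eq_span r₀ hc hsplit₀ τ₀]
    haveI := PeriodRingData.finiteDimensional_span_image (E := E)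
      (𝔅.coeffIncl (E := E) 1) (𝔅.labelD (FramedRep.toContinuousRep r₀) τ₀.toRingHom)
    infer_instance
  have h1' : Module.finrank E (𝔅.labelD (FramedRep.toContinuousRep
      (r₀.baseChange (algebraMap E₀ E) hc)) (extEmb (E := E) τ₀).toRingHom) = 1 := by
    rw [𝔅.finrank_labelD_baseChange r₀ hc hsplit₀ τ₀, h1]
  -- compare the filtrations of the two lines degree by degree
  rw [labelledHodgeTateWeights_def, labelledHodgeTateWeights_def]
  congr 1
  funext i
  rw [𝔅.finrank_labelFilD_eq_ite_of_finrank_eq_one _ _ h1' hιD hι0 i,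
    𝔅.finrank_labelFilD_eq_ite_of_finrank_eq_one _ _ h1 hx₀D hx₀ i]
  by_cases h : x₀ ∈ 𝔅.coeffFilTensor E₀ (Fin 1 → E₀) i
  · rw [if_pos h, if_pos ((𝔅.coeffIncl_mem_coeffFilTensor_iff 1 i x₀).2 h)]
  · rw [if_neg h, if_neg (fun h' => h ((𝔅.coeffIncl_mem_coeffFilTensor_iff 1 i x₀).1 h'))]

end Descent

end PeriodRingData

end Literature.NumberTheory.GaloisRepresentations

end
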